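import Mathlib

/-!
# Dimock, *The renormalization group according to Balaban* II (large fields), §3.5 "new small field region" and §3.10
# "new characteristic functions": the PARTITIONS OF UNITY by large-field regions, `Ω_{k+1} = (Λ̄_k)^{5♮} − P^{5*}_{k+1}`
# (snafu), `Λ_{k+1} = Ω^{5♮}_{k+1} − (Q^{5*}_{k+1} ∪ R^{5*}_{k+1})` (breakup)–(breakup3), the `5[r_{k+1}]` separation and
# «𝒞_{k+1}(Ω_{k+1},Λ_{k+1}) enforces the bounds on Λ^{4*}_{k+1}» — PROVED as layer combinatorics of unions of cubes

**Citation header (reproduction of PUBLISHED work; template of the Bałaban lattice Yang–Mills cell).**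
J. Dimock, *The renormalization group according to Balaban II. Large fields*, J. Math. Phys. **54** (2013) 092301
(= arXiv:1212.5562v2) [Dimock2013BalabanII], §3.5 `\subsection{new small field region} \label{nsf}` TeX L2688–2746
((nothing) L2700–2708, the partition of unity L2710–2721, `Ω_{k+1}` and the separation L2721–2727, (snafu) L2731–2739,
(sub) L2740–2743; §3.1.5 L1864–1867 for the iterated `*`) and §3.10 `\subsection{new characteristic functions}` L3600–3699 ((not) L3609–3619, the two partitions
L3621–3650, (breakup) L3653–3658, `Λ_{k+1}` L3659–3663, (breakup2)–(breakup3) L3664–3675, the enforcing paragraph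
L3677–3682).  TeX line numbers refer to the arXiv source held by the cell on this hub at
`run/shared/lean/archive/nearmiss/qft-balaban/dimock/src/1212.5562/1212.5562.tex` (7217 lines, sha256[:16]
75c5792fc48eacbc); every quotation below was read there this session.  Dimock's papers are published and refereed and
are the cell's TEMPLATE, not manuscripts under audit; no quantity of the Bałaban series is touched.

**What the paper prints (verbatim).**  §3.5 L2710–2729: *"Then with ζ^q_k(□) = 1 − χ^q_k(□)  1 = Π_{□⊂Λ̄_k} ζ^q_k(□) +
χ^q_k(□) = Σ_{P_{k+1}⊂Λ̄_k} Π_{□⊂P_{k+1}} ζ^q_k(□) Π_{□⊂Λ̄_k−P_{k+1}} χ^q_k(□) ≡ Σ_{P_{k+1}⊂Λ̄_k} ζ^q_k(P_{k+1})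
χ^q_k(Λ̄_k − P_{k+1}) where P_{k+1} is a union of LM-cubes.  Now given Λ̄_k and P_{k+1} define a new small field region
Ω_{k+1} by Ω_{k+1} = (Λ̄_k)^{5♮} − P^{5*}_{k+1} or Ω^c_{k+1} = (Λ̄_k)^{c,5*} ∪ P^{5*}_{k+1}  Here the \*, ♮ operations refer
to adding or deleting layers of LM-cubes. In generating Ω^c_{k+1} from (Λ̄_k)^c we add at least 5[r_{k+1}] layers of
LM-cubes so d((Λ̄_k)^c, Ω_{k+1}) ≥ 5[r_{k+1}]LM. This is the required separation at this scale."*  L2732–2746: *"Now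
classify the terms in the sum by the union of LM-cubes Ω_{k+1} that they generate and find 1 = Σ_{Ω_{k+1}⊂Λ̄^{5♮}_k}
𝒞^q_k(Λ_k, Ω_{k+1}) χ^q_k(Ω_{k+1})  (snafu) where 𝒞^q_k(Λ_k, Ω_{k+1}) = Σ_{P_{k+1}⊂Λ̄_k : Ω_{k+1} = (Λ̄_k)^{5♮} −
P^{5*}_{k+1}} ζ^q_k(P_{k+1}) χ^q_k((Λ̄_k − P_{k+1}) − Ω_{k+1})  We have |Φ_{k+1} − QΦ_k| ≤ p_k on Ω_{k+1} (sub)"*.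
§3.10 L3653–3682: *"Now we have 1 = Σ_{Q_{k+1},R_{k+1}} ζ⁰_{k+1}(Q_{k+1}) ζʷ_k(R_{k+1}) χ⁰_{k+1}(Ω^♮_{k+1} − Q_{k+1})
χʷ_k(Ω_{k+1} − R_{k+1})  (breakup)  The new large field regions Q_{k+1}, R_{k+1} generate a new small field region
Λ_{k+1}, also a union of LM cubes, defined by Λ_{k+1} = Ω^{5♮}_{k+1} − (Q^{5*}_{k+1} ∪ R^{5*}_{k+1}) … We write Q_{k+1},
R_{k+1} → Λ_{k+1} and classify the terms in (breakup) by the Λ_{k+1} that they generate. Thus we have 1 =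
Σ_{Λ_{k+1}⊂Ω^{5♮}_{k+1}} 𝒞_{k+1}(Ω_{k+1},Λ_{k+1})  (breakup2) where 𝒞_{k+1}(Ω_{k+1},Λ_{k+1}) = Σ_{Q_{k+1},R_{k+1}→Λ_{k+1}}
ζ⁰_{k+1}(Q_{k+1}) ζʷ_k(R_{k+1}) χ⁰_{k+1}(Ω^♮_{k+1} − Q_{k+1}) χʷ_k(Ω_{k+1} − R_{k+1})  (breakup3) … Note that
𝒞_{k+1}(Ω_{k+1},Λ_{k+1}) enforces that the bounds (not) and |W_k| ≤ p_{0,k} hold on Λ^{4*}_{k+1}. To see this it suffices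
to show that every term in the sum (breakup3) has this property. But the term with Q_{k+1},R_{k+1} enforces the bounds
(not) on Ω^♮_{k+1} − Q_{k+1} and the bound |W_k| ≤ p_{0,k} on Ω_{k+1} − R_{k+1}. Since both these sets contain Λ^{4*}_{k+1}
we have the result."*

**What is reproduced here (kernel-checked, zero `sorry`; imports Mathlib only).**  Finite combinatorics on an abstract
finite type `C` of cubes (print: the `LM`-cubes) with an integer-valued cube distance `d : C → C → ℕ` (hypotheses
where used: `d x x = 0`, symmetry, triangle inequality — print: the number of layers between cubes), characteristic
functions `χ : C → R` valued in any commutative ring `R` (print: functions of the fields, multiplied pointwise), `ζ = 1 − χ`.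
* §1 LAYERS: `enl d n X` (`X^{n*}`, cubes within `n` layers of `X`), `shr d n X` (`X^{n♮}`, cubes whose `n`-neighbourhood
  lies in `X`); `subset_enl`, `shr_subset`, **`enl_shr_subset_shr`** (`(X^{(a+b)♮})^{a*} ⊆ X^{b♮}`),
  **`enl_disjoint_of_sdiff_enl`** (`(Y − Q^{b*})^{a*} ∩ Q = ∅`, `a ≤ b`); (v1.1) `enl_enl_subset_add` (`(X^{a*})^{b*} ⊆
  X^{(a+b)*}`), **`enl_enl_eq_of_midpoints`**∕**`shr_shr_eq_of_midpoints`** (`(X^{a*})^{b*} = X^{(a+b)*}`, `(X^{a♮})^{b♮} =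
  X^{(a+b)♮}` for a cube distance with midpoints), **`enl_iterate_succ`**∕**`shr_iterate_succ`** (`(·^{r*})^{n+1} =
  ·^{(n+1)r*}` — *"X^{2*} = X^{**}, X^{3*} = X^{***}, etc."*: the printed ITERATES are the distance sets).
* §2 `chi χ X = Π_{□∈X} χ(□)`, `zeta χ P = Π_{□∈P}(1 − χ(□))`; **`one_eq_sum_zeta_mul_chi`**: `1 = Σ_{P⊆S} ζ(P)χ(S − P)`
  (Mathlib `Finset.prod_add` on `Π(ζ + χ) = 1`); **`one_eq_double_sum`** = (breakup).
* §3 (§3.5) **`newRegion d n S P`** `= S^{n♮} − P^{n*}` (= `Ω_{k+1}` with `n = 5[r_{k+1}]`), `newRegion_subset_sdiff`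
  (`Ω_{k+1} ⊆ Λ̄_k − P_{k+1}`), **`lt_dist_of_not_mem_of_mem_shr`**∕`lt_dist_of_mem_newRegion` (the separation: `n <
  d(y,x)` for `x ∉ Λ̄_k`, `y ∈ Ω_{k+1}`), **`Cq`** (= `𝒞^q_k(Λ_k,Ω_{k+1})` as printed, a fibre sum),
  **`one_eq_sum_Cq_mul_chi`** = (snafu) `1 = Σ_Ω 𝒞^q(Ω) χ(Ω)` (fibrewise regrouping `Finset.sum_fiberwise` + splitting
  off `χ(Ω)` by `Ω ⊆ Λ̄ − P`).
* §4 (§3.10) **`newLambda d r Ω Q R'`** `= Ω^{5r♮} − (Q^{5r*} ∪ R'^{5r*})`, **`enl_newLambda_subset_shr_sdiff`**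
  (`Λ^{4r*} ⊆ Ω^{r♮} − Q`), **`enl_newLambda_subset_sdiff`** (`Λ^{4r*} ⊆ Ω − R`), **`Cgen`** (= (breakup3), the fibre sum
  over `Q ⊆ Ω^{r♮}`, `R ⊆ Ω`), **`one_eq_sum_Cgen`** = (breakup2) (summed over all `Λ`; non-generated `Λ` contribute `0`),
  **`Cgen_eq_chi_mul`**: `𝒞_{k+1}(Ω,Λ) = χ⁰(Λ^{4r*})·χʷ(Λ^{4r*})·(…)` — every term, hence `𝒞_{k+1}`, CARRIES THE FACTORS
  enforcing (not) and `|W_k| ≤ p_{0,k}` on `Λ^{4*}_{k+1}`.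
* §5 a non-vacuity `example`.

**Readings (declared).**  (i) `X^{n*}`∕`X^{n♮}` are modelled by an abstract integer cube distance (`n` layers = distance
`≤ n`); the print's `[r_{k+1}]`, `5[r_{k+1}]`, `4*` are `r`, `5r`, `4r` layers; `Ω^♮ = Ω^{1♮}` is read as `Ω^{r♮}` (one
unit = `[r_{k+1}]` layers, as in §3.1's conventions for `*`, `♮`).  (ii) Characteristic functions are elements of a
commutative ring (pointwise products of functions of the fields); "enforces a bound on a set" is rendered as "carries
the factor `χ(set)`".  (iii) The sums (snafu)∕(breakup2) are written over ALL unions of cubes `Ω`∕`Λ` (the fibres of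
regions not of the generated form are empty); the ranges of the fibre sums are `Q_{k+1} ⊂ Ω^♮_{k+1}`, `R_{k+1} ⊂ Ω_{k+1}`
per the DEFINING displays L3626 (`Σ_{Q_{k+1}⊂Ω^♮_{k+1}}`) and L3645 (`Σ_{R_{k+1}⊂Ω_{k+1}}`) — the print's sentence L3677
*"The sum is still restricted by P_{k+1} ⊂ Ω^♮_{k+1} and Q_{k+1} ⊂ Ω_{k+1}."* is read accordingly (an apparent letter
shift of the arXiv source, FINDING F-1 of the cross-read at journal l.8941: §3.5's `P_{k+1} ⊂ Λ̄_k` is disjoint from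
`Ω_{k+1} = Λ̄^{5♮}_k − P^{5*}_{k+1}`, so cannot be a standing restriction; recorded, kernel ranges as in L3626∕L3645).
(v) (v1.1) The print's `X^{n*}`∕`X^{n♮}` are ITERATES (*"X^{2*} = X^{**}, X^{3*} = X^{***}, etc."*, L1866–1867) while
`enl d n`∕`shr d n` are distance-`≤ n` sets; §1's `enl_enl_eq_of_midpoints`∕`shr_shr_eq_of_midpoints`∕
`enl_iterate_succ`∕`shr_iterate_succ` prove the two agree for every cube distance with the triangle inequality and
MIDPOINTS (`d(x,z) ≤ a + b ⟹ ∃ y, d(x,y) ≤ a ∧ d(y,z) ≤ b` — true for the layer distance of the torus carrier,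
`TorusCubeLayers.exists_tdist_le_of_le_add`).  (iv) `Λ̄_k` (the union of LM cubes meeting `Λ_k`) is the input set `S`; its construction from `Λ_k`
is not modelled.

**What is NOT claimed.**  The characteristic functions themselves ((nothing), (not), `χ^w_k`) as functions of the
fields and the bounds they encode (Lemma `suddsy` (gb2) is kernel in `SmallFieldBounds`, v8.51); the insertion under the
integral (representation6); the metric facts of the actual `LM`-cube geometry of `𝕋^{−k}_{𝖬+𝖭−k}` (the distance `d` is
abstract); §3.11 (redundant characteristic functions), Lemma 3.14; anything of B1–B16 (TEMPLATE.md §4.2 rows «D2 §3.5»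
and «D2 §3.10» ↔ B14 §3 (3.1)ff ∕ B14 p. 245 «Many new characteristic functions appear …» — grade T, untouched).  NOT
summit progress; NOT a statement about any Bałaban paper; NOT continuum; NOT Clay.  Imports Mathlib only; no Summits
import; sub-namespace `…Dimock2011to13.CharacteristicFunctionSplit`; modifies nothing.  Unit `b2b-balaban-template`
gen 34 (journal CLAIM D2-BREAKUP-KERNEL); v1.1 gen 35 (journal CLAIM D2-BREAKUP-ITERATE: §1 iterate identities added, reading
(v), reading (iii) and locators L2725–2727∕L2740–2743∕L3679–3683 corrected per the cross-read of journal l.8941; v1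
statements and proofs unchanged); cell records TEMPLATE.md §4.2 rows «D2 §3.5», «D2 §3.10», GAPS C-tmpl34-3, C-tmpl35-5.
-/

open Finset
open scoped BigOperators

namespace Literature.MathematicalPhysics.QuantumFieldTheory.Dimock2011to13.CharacteristicFunctionSplit

variable {C : Type*} [Fintype C] [DecidableEq C]

/-! ## §1 Layers of cubes: enlargement `X^{n*}` and shrinking `X^{n♮}` for an integer-valued cube distance -/

/-- `X^{n*}`: add `n` layers — the cubes within distance `n` of `X` (*"the \*, ♮ operations refer to adding or deleting
layers of LM-cubes"*). [cite: Dimock2013BalabanII, §3.5 (arXiv:1212.5562v2 TeX L2725–2727)] -/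
def enl (d : C → C → ℕ) (n : ℕ) (X : Finset C) : Finset C := univ.filter fun x => ∃ y ∈ X, d x y ≤ n

/-- `X^{n♮}`: delete `n` layers — the cubes whose whole `n`-neighbourhood lies in `X`.
[cite: Dimock2013BalabanII, §3.5 (arXiv:1212.5562v2 TeX L2725–2727)] -/
def shr (d : C → C → ℕ) (n : ℕ) (X : Finset C) : Finset C := univ.filter fun x => ∀ z, d x z ≤ n → z ∈ X

variable {d : C → C → ℕ}

omit [DecidableEq C] in
/-- Membership in `X^{n*}`. [folklore] -/
private theorem mem_enl {n : ℕ} {X : Finset C} {x : C} : x ∈ enl d n X ↔ ∃ y ∈ X, d x y ≤ n := by simp [enl]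

/-- Membership in `X^{n♮}`. [folklore] -/
private theorem mem_shr {n : ℕ} {X : Finset C} {x : C} : x ∈ shr d n X ↔ ∀ z, d x z ≤ n → z ∈ X := by simp [shr]

omit [DecidableEq C] in
/-- `X ⊆ X^{n*}` (a cube is at distance `0` from itself; *"adding … layers"*). [cite: Dimock2013BalabanII, §3.5 (arXiv:1212.5562v2 TeX L2725–2727)] -/
theorem subset_enl (hd0 : ∀ x, d x x = 0) (n : ℕ) (X : Finset C) : X ⊆ enl d n X :=
  fun x hx => mem_enl.2 ⟨x, hx, by simp [hd0]⟩

/-- `X^{n♮} ⊆ X` (*"deleting layers"*). [cite: Dimock2013BalabanII, §3.5 (arXiv:1212.5562v2 TeX L2725–2727)] -/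
theorem shr_subset (hd0 : ∀ x, d x x = 0) (n : ℕ) (X : Finset C) : shr d n X ⊆ X :=
  fun x hx => (mem_shr.1 hx) x (by simp [hd0])

/-- `(X^{(a+b)♮})^{a*} ⊆ X^{b♮}` (triangle inequality): enlarging a shrunk region by fewer layers than were deleted stays
inside a shrinking — the layer arithmetic behind *"Since both these sets contain Λ^{4*}_{k+1}"*.
[cite: Dimock2013BalabanII, §3.10 (arXiv:1212.5562v2 TeX L3679–3683)] -/
theorem enl_shr_subset_shr (htri : ∀ x y z, d x z ≤ d x y + d y z) (hsymm : ∀ x y, d x y = d y x) {a b : ℕ}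
    (X : Finset C) : enl d a (shr d (a + b) X) ⊆ shr d b X := by
  intro x hx
  obtain ⟨y, hy, hxy⟩ := mem_enl.1 hx
  refine mem_shr.2 fun z hz => (mem_shr.1 hy) z ?_
  calc d y z ≤ d y x + d x z := htri y x z
    _ ≤ a + b := by rw [hsymm y x]; exact Nat.add_le_add hxy hz

/-- `(Y − Q^{b*})^{a*}` misses `Q` for `a ≤ b` (a region cut out with a `b`-collar around `Q` stays `b − a` layers away
from `Q` after adding `a` layers). [cite: Dimock2013BalabanII, §3.10 (arXiv:1212.5562v2 TeX L3659–3677)] -/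
theorem enl_disjoint_of_sdiff_enl (hsymm : ∀ x y, d x y = d y x) {a b : ℕ} (hab : a ≤ b) {Y Q : Finset C}
    {Λ : Finset C} (hΛ : Λ ⊆ Y \ enl d b Q) : Disjoint (enl d a Λ) Q := by
  rw [Finset.disjoint_left]
  intro x hx hxQ
  obtain ⟨y, hy, hxy⟩ := mem_enl.1 hx
  have hy' := (mem_sdiff.1 (hΛ hy)).2
  exact hy' (mem_enl.2 ⟨x, hxQ, by rw [hsymm]; exact hxy.trans hab⟩)

omit [DecidableEq C] in
/-- `(X^{a*})^{b*} ⊆ X^{(a+b)*}` (triangle inequality). [cite: Dimock2013BalabanII, §3.1.5 (arXiv:1212.5562v2 TeX L1849–1851, L1864–1867)] -/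
theorem enl_enl_subset_add (htri : ∀ x y z, d x z ≤ d x y + d y z) {a b : ℕ} (X : Finset C) :
    enl d b (enl d a X) ⊆ enl d (a + b) X := by
  intro x hx
  obtain ⟨y, hy, hxy⟩ := mem_enl.1 hx
  obtain ⟨w, hw, hyw⟩ := mem_enl.1 hy
  exact mem_enl.2 ⟨w, hw, (htri x y w).trans (by omega)⟩

omit [DecidableEq C] in
/-- **`(X^{a*})^{b*} = X^{(a+b)*}`** for a cube distance with the triangle inequality and MIDPOINTS (`d(x,z) ≤ a + b ⟹
∃ y, d(x,y) ≤ a ∧ d(y,z) ≤ b`): adding `a` layers and then `b` layers is adding `a + b` layers, so the printed iterates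
*"X^{2*} = X^{**}, X^{3*} = X^{***}, etc."* ARE the distance-`≤` enlargements of this file. [cite: Dimock2013BalabanII, §3.1.5 (arXiv:1212.5562v2 TeX L1864–1867); §3.5 L2725–2727] -/
theorem enl_enl_eq_of_midpoints (htri : ∀ x y z, d x z ≤ d x y + d y z)
    (hmid : ∀ x z a b, d x z ≤ a + b → ∃ y, d x y ≤ a ∧ d y z ≤ b) {a b : ℕ} (X : Finset C) :
    enl d b (enl d a X) = enl d (a + b) X := by
  refine Subset.antisymm (enl_enl_subset_add htri X) fun x hx => ?_
  obtain ⟨w, hw, hxw⟩ := mem_enl.1 hx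
  obtain ⟨y, hxy, hyw⟩ := hmid x w b a (by omega)
  exact mem_enl.2 ⟨y, mem_enl.2 ⟨w, hw, hyw⟩, hxy⟩

/-- **`(X^{a♮})^{b♮} = X^{(a+b)♮}`** under the same hypotheses: deleting `a` layers and then `b` layers is deleting
`a + b` layers (*"X^{♮} = X_k shrunk by [r_k] layers of M blocks = ((X^c)^*)^c"*, *"X^{2♮} = X^{♮♮}, X^{3♮} =
X^{♮♮♮}, etc."*). [cite: Dimock2013BalabanII, §3.1.5 (arXiv:1212.5562v2 TeX L1868–1872); §3.5 L2725–2727] -/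
theorem shr_shr_eq_of_midpoints (htri : ∀ x y z, d x z ≤ d x y + d y z)
    (hmid : ∀ x z a b, d x z ≤ a + b → ∃ y, d x y ≤ a ∧ d y z ≤ b) {a b : ℕ} (X : Finset C) :
    shr d b (shr d a X) = shr d (a + b) X := by
  ext x
  rw [mem_shr, mem_shr]
  constructor
  · intro h w hxw
    obtain ⟨z, hxz, hzw⟩ := hmid x w b a (by omega)
    exact (mem_shr.1 (h z hxz)) w hzw
  · intro h z hxz
    exact mem_shr.2 fun w hzw => h w ((htri x z w).trans (by omega))

omit [DecidableEq C] in
/-- **`X^{n*}` is the `n`-fold iterate of `X^*`** (*"X^{2*} = X^{**}, X^{3*} = X^{***}, etc."*): `(·^{r*})^{n+1} X =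
X^{(n+1)r*}` for a cube distance with the triangle inequality and midpoints. [cite: Dimock2013BalabanII, §3.1.5 (arXiv:1212.5562v2 TeX L1864–1867)] -/
theorem enl_iterate_succ (htri : ∀ x y z, d x z ≤ d x y + d y z)
    (hmid : ∀ x z a b, d x z ≤ a + b → ∃ y, d x y ≤ a ∧ d y z ≤ b) (r n : ℕ) (X : Finset C) :
    (enl d r)^[n + 1] X = enl d ((n + 1) * r) X := by
  induction n with
  | zero => simp
  | succ n ih =>
    rw [Function.iterate_succ_apply', ih, enl_enl_eq_of_midpoints htri hmid]
    congr 1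
    ring

/-- **`X^{n♮}` is the `n`-fold iterate of `X^♮`** (*"X^{2♮} = X^{♮♮}, X^{3♮} = X^{♮♮♮}, etc."*). [cite: Dimock2013BalabanII, §3.1.5 (arXiv:1212.5562v2 TeX L1868–1872)] -/
theorem shr_iterate_succ (htri : ∀ x y z, d x z ≤ d x y + d y z)
    (hmid : ∀ x z a b, d x z ≤ a + b → ∃ y, d x y ≤ a ∧ d y z ≤ b) (r n : ℕ) (X : Finset C) :
    (shr d r)^[n + 1] X = shr d ((n + 1) * r) X := by
  induction n with
  | zero => simp
  | succ n ih =>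
    rw [Function.iterate_succ_apply', ih, shr_shr_eq_of_midpoints htri hmid]
    congr 1
    ring

/-! ## §2 Characteristic functions of unions of cubes and the partition of unity -/

section Ring

variable {R : Type*} [CommRing R]

/-- `χ(X) = Π_{□⊂X} χ(□)` (a characteristic function of a union of cubes is the product over its cubes).
[cite: Dimock2013BalabanII, §3.5 eq. (nothing) and the display after it (arXiv:1212.5562v2 TeX L2700–2721)] -/
def chi (χ : C → R) (X : Finset C) : R := ∏ c ∈ X, χ c

/-- `ζ(P) = Π_{□⊂P} ζ(□)` with `ζ(□) = 1 − χ(□)`. [cite: Dimock2013BalabanII, §3.5 display after (nothing)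
(arXiv:1212.5562v2 TeX L2710–2721)] -/
def zeta (χ : C → R) (P : Finset C) : R := ∏ c ∈ P, (1 - χ c)

omit [Fintype C] in
/-- `χ(X ∪ Y) = χ(X)χ(Y)` for disjoint unions. [folklore] -/
private theorem chi_union {χ : C → R} {X Y : Finset C} (h : Disjoint X Y) : chi χ (X ∪ Y) = chi χ X * chi χ Y := by
  unfold chi; rw [prod_union h]

omit [Fintype C] in
/-- `χ(X) = χ(X − Ω)·χ(Ω)` for `Ω ⊆ X`. [folklore] -/
private theorem chi_eq_chi_sdiff_mul {χ : C → R} {X Ω : Finset C} (h : Ω ⊆ X) : chi χ X = chi χ (X \ Ω) * chi χ Ω := by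
  rw [← chi_union sdiff_disjoint, sdiff_union_of_subset h]

omit [Fintype C] in
/-- **The partition of unity by large-field regions**: `1 = Π_{□⊂S}(ζ(□) + χ(□)) = Σ_{P⊂S} ζ(P) χ(S − P)` —
*"1 = Π_{□⊂Λ̄_k} ζ^q_k(□) + χ^q_k(□) = Σ_{P_{k+1}⊂Λ̄_k} Π_{□⊂P_{k+1}} ζ^q_k(□) Π_{□⊂Λ̄_k−P_{k+1}} χ^q_k(□) ≡ Σ_{P_{k+1}⊂Λ̄_k}
ζ^q_k(P_{k+1}) χ^q_k(Λ̄_k − P_{k+1})"*, for characteristic functions valued in any commutative ring (functions of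
the fields). [cite: Dimock2013BalabanII, §3.5 display after (nothing) (arXiv:1212.5562v2 TeX L2710–2721); §3.10 (L3621–3629, L3640–3650)] -/
theorem one_eq_sum_zeta_mul_chi (χ : C → R) (S : Finset C) :
    (1 : R) = ∑ P ∈ S.powerset, zeta χ P * chi χ (S \ P) := by
  have h : ∏ c ∈ S, ((1 - χ c) + χ c) = 1 := by simp
  rw [← h, prod_add]
  rfl

omit [Fintype C] in
/-- **(breakup)**: the product of two partitions of unity (background cubes `□ ⊂ S₀`, fluctuation cubes `□ ⊂ S_w`):
`1 = Σ_{Q⊂S₀, R⊂S_w} ζ⁰(Q) ζʷ(R) χ⁰(S₀ − Q) χʷ(S_w − R)`. [cite: Dimock2013BalabanII, §3.10 eq. (breakup) (arXiv:1212.5562v2 TeX L3653–3658)] -/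
theorem one_eq_double_sum (χ₀ χw : C → R) (S₀ Sw : Finset C) :
    (1 : R) = ∑ Q ∈ S₀.powerset, ∑ R' ∈ Sw.powerset,
      zeta χ₀ Q * zeta χw R' * chi χ₀ (S₀ \ Q) * chi χw (Sw \ R') := by
  have h0 := one_eq_sum_zeta_mul_chi χ₀ S₀
  have hw := one_eq_sum_zeta_mul_chi χw Sw
  calc (1 : R) = 1 * 1 := (mul_one 1).symm
    _ = (∑ Q ∈ S₀.powerset, zeta χ₀ Q * chi χ₀ (S₀ \ Q)) * ∑ R' ∈ Sw.powerset, zeta χw R' * chi χw (Sw \ R') := by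
        rw [← h0, ← hw]
    _ = _ := by
        rw [sum_mul_sum]
        refine sum_congr rfl fun Q _ => sum_congr rfl fun R' _ => ?_
        ring

end Ring

/-! ## §3 §3.5: the new small-field region `Ω_{k+1} = Λ̄_k^{5♮} − P_{k+1}^{5*}` and the resummation (snafu) -/

section NewRegion

variable {R : Type*} [CommRing R]

/-- **`Ω_{k+1} = (Λ̄_k)^{5♮} − P^{5*}_{k+1}`** (with `[r_{k+1}]` layers per unit: `n = 5[r_{k+1}]`).
[cite: Dimock2013BalabanII, §3.5 (arXiv:1212.5562v2 TeX L2723–2729)] -/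
def newRegion (d : C → C → ℕ) (n : ℕ) (S P : Finset C) : Finset C := shr d n S \ enl d n P

/-- `Ω_{k+1} ⊆ Λ̄_k − P_{k+1}`. [cite: Dimock2013BalabanII, §3.5 (arXiv:1212.5562v2 TeX L2723–2745)] -/
theorem newRegion_subset_sdiff (hd0 : ∀ x, d x x = 0) (n : ℕ) (S P : Finset C) :
    newRegion d n S P ⊆ S \ P := by
  intro x hx
  obtain ⟨hxS, hxP⟩ := mem_sdiff.1 hx
  exact mem_sdiff.2 ⟨shr_subset hd0 n S hxS, fun h => hxP (subset_enl hd0 n P h)⟩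

/-- **The separation**: *"In generating Ω^c_{k+1} from (Λ̄_k)^c we add at least 5[r_{k+1}] layers of LM-cubes so
d((Λ̄_k)^c, Ω_{k+1}) ≥ 5[r_{k+1}]LM"* — every cube outside `S` is at distance `> n` from every cube of `S^{n♮}`.
[cite: Dimock2013BalabanII, §3.5 (arXiv:1212.5562v2 TeX L2727–2729)] -/
theorem lt_dist_of_not_mem_of_mem_shr {n : ℕ} {S : Finset C} {x y : C} (hx : x ∉ S) (hy : y ∈ shr d n S) :
    n < d y x := by
  by_contra h
  exact hx ((mem_shr.1 hy) x (not_lt.1 h))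

/-- The separation for `Ω_{k+1}`: cubes outside `Λ̄_k` are more than `n` layers from `Ω_{k+1}`.
[cite: Dimock2013BalabanII, §3.5 (arXiv:1212.5562v2 TeX L2727–2729)] -/
theorem lt_dist_of_mem_newRegion {n : ℕ} {S P : Finset C} {x y : C} (hx : x ∉ S) (hy : y ∈ newRegion d n S P) :
    n < d y x :=
  lt_dist_of_not_mem_of_mem_shr hx (mem_sdiff.1 hy).1

/-- **`𝒞^q_k(Λ_k, Ω_{k+1}) = Σ_{P_{k+1}⊂Λ̄_k : Ω_{k+1} = (Λ̄_k)^{5♮} − P^{5*}_{k+1}} ζ^q_k(P_{k+1}) χ^q_k((Λ̄_k − P_{k+1}) − Ω_{k+1})`**.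
[cite: Dimock2013BalabanII, §3.5 display after (snafu) (arXiv:1212.5562v2 TeX L2737–2742)] -/
def Cq (d : C → C → ℕ) (n : ℕ) (χ : C → R) (S Ω : Finset C) : R :=
  ∑ P ∈ S.powerset with newRegion d n S P = Ω, zeta χ P * chi χ ((S \ P) \ Ω)

/-- **(snafu)**: *"Now classify the terms in the sum by the union of LM-cubes Ω_{k+1} that they generate and find
1 = Σ_{Ω_{k+1}⊂Λ̄^{5♮}_k} 𝒞^q_k(Λ_k, Ω_{k+1}) χ^q_k(Ω_{k+1})"* — summed here over ALL unions of cubes `Ω` (those not of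
the form `(Λ̄_k)^{5♮} − P^{5*}` have an empty fibre, `𝒞^q = 0`); the factor `χ^q_k(Ω_{k+1})` is (sub) *"|Φ_{k+1} − QΦ_k| ≤
p_k on Ω_{k+1}"*, split off by `Ω_{k+1} ⊆ Λ̄_k − P_{k+1}`. [cite: Dimock2013BalabanII, §3.5 eqs. (snafu), (sub) (arXiv:1212.5562v2 TeX L2732–2746)] -/
theorem one_eq_sum_Cq_mul_chi (hd0 : ∀ x, d x x = 0) (n : ℕ) (χ : C → R) (S : Finset C) :
    (1 : R) = ∑ Ω : Finset C, Cq d n χ S Ω * chi χ Ω := by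
  rw [one_eq_sum_zeta_mul_chi χ S,
    ← Finset.sum_fiberwise S.powerset (newRegion d n S) (fun P => zeta χ P * chi χ (S \ P))]
  refine sum_congr rfl fun Ω _ => ?_
  rw [Cq, sum_mul]
  refine sum_congr rfl fun P hP => ?_
  obtain ⟨-, hgen⟩ := mem_filter.1 hP
  have hΩ : Ω ⊆ S \ P := hgen ▸ newRegion_subset_sdiff hd0 n S P
  rw [chi_eq_chi_sdiff_mul hΩ]
  ring

end NewRegion

/-! ## §4 §3.10: the new large-field regions `Q_{k+1}, R_{k+1}`, the region `Λ_{k+1} = Ω^{5♮}_{k+1} − (Q^{5*} ∪ R^{5*})`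
and what `𝒞_{k+1}(Ω_{k+1}, Λ_{k+1})` enforces on `Λ^{4*}_{k+1}` -/

section NewLambda

variable {R : Type*} [CommRing R]

/-- **`Λ_{k+1} = Ω^{5♮}_{k+1} − (Q^{5*}_{k+1} ∪ R^{5*}_{k+1})`** (`n = [r_{k+1}]` layers per unit).
[cite: Dimock2013BalabanII, §3.10 (arXiv:1212.5562v2 TeX L3659–3663)] -/
def newLambda (d : C → C → ℕ) (r : ℕ) (Ω Q R' : Finset C) : Finset C :=
  shr d (5 * r) Ω \ (enl d (5 * r) Q ∪ enl d (5 * r) R')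

/-- **`Λ^{4*}_{k+1} ⊆ Ω^♮_{k+1} − Q_{k+1}`** (`Ω^♮ = Ω^{1♮}`): the triangle inequality `4[r] + [r] ≤ 5[r]` and the
`5[r]`-collar around `Q`. [cite: Dimock2013BalabanII, §3.10 (arXiv:1212.5562v2 TeX L3679–3683)] -/
theorem enl_newLambda_subset_shr_sdiff (htri : ∀ x y z, d x z ≤ d x y + d y z) (hsymm : ∀ x y, d x y = d y x)
    (r : ℕ) (Ω Q R' : Finset C) : enl d (4 * r) (newLambda d r Ω Q R') ⊆ shr d r Ω \ Q := by
  intro x hx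
  refine mem_sdiff.2 ⟨?_, ?_⟩
  · have h1 : enl d (4 * r) (newLambda d r Ω Q R') ⊆ enl d (4 * r) (shr d (4 * r + r) Ω) := by
      intro y hy
      obtain ⟨z, hz, hyz⟩ := mem_enl.1 hy
      refine mem_enl.2 ⟨z, ?_, hyz⟩
      have := (mem_sdiff.1 hz).1
      rwa [show 5 * r = 4 * r + r by ring] at this
    exact enl_shr_subset_shr htri hsymm Ω (h1 hx)
  · have hΛ : newLambda d r Ω Q R' ⊆ shr d (5 * r) Ω \ enl d (5 * r) Q := fun y hy => by
      obtain ⟨h1, h2⟩ := mem_sdiff.1 hy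
      exact mem_sdiff.2 ⟨h1, fun h => h2 (mem_union_left _ h)⟩
    have hdis : Disjoint (enl d (4 * r) (newLambda d r Ω Q R')) Q :=
      enl_disjoint_of_sdiff_enl hsymm (by omega : 4 * r ≤ 5 * r) hΛ
    exact Finset.disjoint_left.1 hdis hx

/-- **`Λ^{4*}_{k+1} ⊆ Ω_{k+1} − R_{k+1}`**. [cite: Dimock2013BalabanII, §3.10 (arXiv:1212.5562v2 TeX L3679–3683)] -/
theorem enl_newLambda_subset_sdiff (htri : ∀ x y z, d x z ≤ d x y + d y z) (hsymm : ∀ x y, d x y = d y x)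
    (hd0 : ∀ x, d x x = 0) (r : ℕ) (Ω Q R' : Finset C) : enl d (4 * r) (newLambda d r Ω Q R') ⊆ Ω \ R' := by
  intro x hx
  refine mem_sdiff.2 ⟨?_, ?_⟩
  · have h := enl_newLambda_subset_shr_sdiff htri hsymm r Ω Q R' hx
    exact shr_subset hd0 r Ω (mem_sdiff.1 h).1
  · have hΛ : newLambda d r Ω Q R' ⊆ shr d (5 * r) Ω \ enl d (5 * r) R' := fun y hy => by
      obtain ⟨h1, h2⟩ := mem_sdiff.1 hy
      exact mem_sdiff.2 ⟨h1, fun h => h2 (mem_union_right _ h)⟩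
    have hdis : Disjoint (enl d (4 * r) (newLambda d r Ω Q R')) R' :=
      enl_disjoint_of_sdiff_enl hsymm (by omega : 4 * r ≤ 5 * r) hΛ
    exact Finset.disjoint_left.1 hdis hx

/-- **`𝒞_{k+1}(Ω_{k+1}, Λ_{k+1}) = Σ_{Q_{k+1},R_{k+1} → Λ_{k+1}} ζ⁰_{k+1}(Q_{k+1}) ζʷ_k(R_{k+1}) χ⁰_{k+1}(Ω^♮_{k+1} − Q_{k+1})
χʷ_k(Ω_{k+1} − R_{k+1})`** (`Q ⊂ Ω^♮`, `R ⊂ Ω`). [cite: Dimock2013BalabanII, §3.10 eq. (breakup3) (arXiv:1212.5562v2 TeX L3669–3675)] -/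
def Cgen (d : C → C → ℕ) (r : ℕ) (χ₀ χw : C → R) (Ω Λ : Finset C) : R :=
  ∑ Q ∈ (shr d r Ω).powerset, ∑ R' ∈ Ω.powerset with newLambda d r Ω Q R' = Λ,
    zeta χ₀ Q * zeta χw R' * chi χ₀ (shr d r Ω \ Q) * chi χw (Ω \ R')

/-- **(breakup2)**: `1 = Σ_{Λ_{k+1}} 𝒞_{k+1}(Ω_{k+1}, Λ_{k+1})` (*"We write Q_{k+1}, R_{k+1} → Λ_{k+1} and classify the
terms in (breakup) by the Λ_{k+1} that they generate"*); summed here over ALL unions of cubes `Λ` — the ones not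
generated have an empty fibre and contribute `0`.
[cite: Dimock2013BalabanII, §3.10 eqs. (breakup2)–(breakup3) (arXiv:1212.5562v2 TeX L3664–3675)] -/
theorem one_eq_sum_Cgen (r : ℕ) (χ₀ χw : C → R) (Ω : Finset C) :
    (1 : R) = ∑ Λ : Finset C, Cgen d r χ₀ χw Ω Λ := by
  have h1 : (1 : R) = ∑ p ∈ (shr d r Ω).powerset ×ˢ Ω.powerset,
      zeta χ₀ p.1 * zeta χw p.2 * chi χ₀ (shr d r Ω \ p.1) * chi χw (Ω \ p.2) := by
    rw [sum_product]
    exact one_eq_double_sum χ₀ χw (shr d r Ω) Ω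
  have h2 := Finset.sum_fiberwise ((shr d r Ω).powerset ×ˢ Ω.powerset)
    (fun p : Finset C × Finset C => newLambda d r Ω p.1 p.2)
    (fun p : Finset C × Finset C => zeta χ₀ p.1 * zeta χw p.2 * chi χ₀ (shr d r Ω \ p.1) * chi χw (Ω \ p.2))
  rw [h1, ← h2]
  refine sum_congr rfl fun Λ _ => ?_
  rw [Cgen, sum_filter, sum_product]
  refine sum_congr rfl fun Q _ => ?_
  rw [sum_filter]

/-- **What `𝒞_{k+1}(Ω_{k+1}, Λ_{k+1})` enforces**: *"𝒞_{k+1}(Ω_{k+1},Λ_{k+1}) enforces that the bounds (not) and |W_k| ≤ p_{0,k}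
hold on Λ^{4*}_{k+1}. To see this it suffices to show that every term in the sum (breakup3) has this property. But the
term with Q_{k+1},R_{k+1} enforces the bounds (not) on Ω^♮_{k+1} − Q_{k+1} and the bound |W_k| ≤ p_{0,k} on Ω_{k+1} −
R_{k+1}. Since both these sets contain Λ^{4*}_{k+1} we have the result"* — in the ring: every term, hence `𝒞_{k+1}`,
carries the factor `χ⁰(Λ^{4*}) χʷ(Λ^{4*})`. [cite: Dimock2013BalabanII, §3.10 (arXiv:1212.5562v2 TeX L3664–3683)] -/
theorem Cgen_eq_chi_mul (htri : ∀ x y z, d x z ≤ d x y + d y z) (hsymm : ∀ x y, d x y = d y x)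
    (hd0 : ∀ x, d x x = 0) (r : ℕ) (χ₀ χw : C → R) (Ω Λ : Finset C) :
    Cgen d r χ₀ χw Ω Λ
      = chi χ₀ (enl d (4 * r) Λ) * chi χw (enl d (4 * r) Λ) *
        ∑ Q ∈ (shr d r Ω).powerset, ∑ R' ∈ Ω.powerset with newLambda d r Ω Q R' = Λ,
          zeta χ₀ Q * zeta χw R' * chi χ₀ ((shr d r Ω \ Q) \ enl d (4 * r) Λ)
            * chi χw ((Ω \ R') \ enl d (4 * r) Λ) := by
  rw [Cgen, mul_sum]
  refine sum_congr rfl fun Q _ => ?_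
  rw [mul_sum]
  refine sum_congr rfl fun R' hR' => ?_
  obtain ⟨-, hgen⟩ := mem_filter.1 hR'
  have h1 : enl d (4 * r) Λ ⊆ shr d r Ω \ Q := hgen ▸ enl_newLambda_subset_shr_sdiff htri hsymm r Ω Q R'
  have h2 : enl d (4 * r) Λ ⊆ Ω \ R' := hgen ▸ enl_newLambda_subset_sdiff htri hsymm hd0 r Ω Q R'
  rw [chi_eq_chi_sdiff_mul h1, chi_eq_chi_sdiff_mul h2]
  ring

end NewLambda

/-! ## §5 Non-vacuity -/

/-- The identities are unconditional; e.g. three cubes in a row with the graph distance `|i − j|`, one layer per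
unit, constant characteristic functions. -/
example : (1 : ℤ) = ∑ Λ : Finset (Fin 3),
    Cgen (fun i j : Fin 3 => (i : ℕ).dist j) 1 (fun _ => (2 : ℤ)) (fun _ => 3) univ Λ :=
  one_eq_sum_Cgen 1 _ _ _

end Literature.MathematicalPhysics.QuantumFieldTheory.Dimock2011to13.CharacteristicFunctionSplit
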